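import Summits.Ventures.HSemireg.AmplificationChainSigmaGluable
import Literature.AlgebraicGeometry.HodgeTheory.TwistedPerfectAdmissibilityInitialSegment
import Literature.AlgebraicGeometry.HodgeTheory.SemiregularityEulerFormBarrier
import HarnessLib

/-!
# `SheafSeedGaussSq` (stmt-HodgeConjecture-30548), line `secant-q824` (v5): the EULER SQUEEZE for fully semiregular
# secant objects on an abelian FOURFOLD — no witness with `dim Hom(E,E) ≤ 2` (the negative answer to Markman's Question 8.2.4)

Negative lemmas of the standing disprover (`cdisprove-stmt-HodgeConjecture-30548`, generation 1) for the rung of record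
`SecantQ824.stub_rung_secantObjectsQ824 : ∀ C, ∃ D : GenusFourSecantDatum, D.j = 1 ∧ D.HasSecantObjects C AdmTwP`
(`Cruxes/SheafSeedGaussSq/Lines/secant_q824.lean` v5), `AdmTwP = gluableSigmaAdmissible ∨ bfSingleAdmissible'`. Both disjuncts of
`AdmTwP` test the FULL Buchweitz–Flenner map `σ = (σ_q)_{q ≤ 3}` for injectivity on `Ext²(E,E)` (the secant objects have every
degree `p ≤ 4` in `I`), and `Ext^{<0}(E,E) = 0` (a conjunct of `gluableSigmaAdmissible`; automatic for the single vector bundle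
of `bfSingleAdmissible'`). For such an `E` on an abelian FOURFOLD `B` whose twisted Chern character `exp(B₀)·ch(E)` lies on a
`K`-secant plane of a polarization (`π^*κ = x·Re exp(√-d θ) + y·Im exp(√-d θ)/√d`, `(x,y) ≠ 0`, `π : A → B` an isogeny, `θ`
a polarization class on the fourfold `A`) the computation cell `pub-hsemireg` derived and signed (NOGO-n4.md §2/§8/§9,
Q824-NO.md v2, 2026-08-22; owner s0-3, referee ✓✓, independent second proof by Lombardi–Tirabassi for Jacobians) the COUNT

  `e₂ = 12`, `e₁ ≥ 8`, `e₃ = e₁`, `e₄ = e₀`, `χ(E,E) = e₀ − e₁ + e₂ − e₃ + e₄ = (1/deg π)·8d(dx² + y²)·∫_A θ⁴/4! > 0`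

(`e_k = dim Ext^k(E,E)`), from: [BuchweitzFlenner2008HH] Prop. 6.4.4 / Thm. 6.4.2 (`σ_E ∘ ob_E = ⌟ch(E)` on `HT^•`, every
perfect complex) and the exterior-algebra ranks `rank(⌟κ | HT¹) = 8`, `rank(⌟κ | HT²) = 12` of every non-zero class of a secant
plane on a fourfold (period-free; three codes in the cell, re-checked exactly by this seat: `compute/contraction_ranks.out` in the
item's evidence — `(f₁,f₂,f₃,f₄) = (8,12,8,1)` at every `d`, every `(x,y) ≠ 0`, twist-invariant); the duality
`⟨σ²(e), ξ⟩_Serre = ±Tr(e ∘ ob²(ξ))` (Ω-linearity of the trace, [BuchweitzFlenner2003] §4.1; `ω_B ≅ 𝒪_B`), whence «`σ²` injective ⟺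
`ob²` surjective» and `e₂ = rank ob² = 12`; Serre duality and Hirzebruch–Riemann–Roch on `B` ([MumfordAV1970] §16); positivity of the
Euler form of a secant class (tree: `Literature.AlgebraicGeometry.HodgeTheory.eulerForm_secant_pos`, `eulerForm_secant_markman`).
CONSEQUENCE: `χ ≤ 2e₀ − 4`, so `e₀ = dim Hom(E,E) ≥ 3` for EVERY fully semiregular secant object on a fourfold; Markman's intended
witness `F̄′ = [𝒪_Y → ν̄_*𝒪_{Z̃/G}]` (arXiv:2502.03415 Question 8.2.4; `e₀ = 1`, `χ = 8d`) is not semiregular at ANY `d` (it would need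
`e₀ ≥ 4d + 2`); at the rung `j = 1` (`deg π = 2`, `d = 1`) any witness has `e₀ ≥ 2 + 2(x² + y²) ≥ 4`, at the fallback `j = 2`
(`d = 4`, `deg π = 5`) `e₀ ≥ 15`. The tree's Literature note `SemiregularityEulerFormBarrier.lean` has the same counting WITHOUT the
duality step (`semiregular_window_dim_four`: `χ ≤ 14`, leaving exactly `d = 1` — the line's rung — open: `markman_examples_window`);
the duality step closes it.

What is proved here, sorry-free (nothing of the preprint or of the cell's derivation is ASSERTED: the count enters §2 as the explicit
hypothesis `hcount`; nothing here says anything about HC / HC_AV / HC_CM / WeilSixfolds / stmt-18881 / stmt-30548):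

* §1 ARITHMETIC of the squeeze: `eulerForm_secantPlane` (`χ_A = 8d(dx²+y²)` in the line's coordinates), `euler_le_of_squeeze`
  (`χ ≤ 2e₀ − 4`), `three_le_endRank_of_squeeze`, `squeeze_false_of_endRank_le_two` (= the cell's NEGATIVE #1, numerical core),
  `markmanFbarPrime_endRank_ge` (`4d + 2 ≤ e₀`), `markmanFbarPrime_extTwo_ne_twelve`, `levelOne_four_le_endRank`,
  `levelTwo_fifteen_le_endRank`, `levelTwo_rankOne_untwisted_false`.
* §2 NOTION LEVEL, for ANY admissibility notion `Adm`, scheme `X₀`, index condition `S` and class pin `Pin` (the line's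
  `HasSecantTwistedObjectOn C Adm d A B π θ` is the instance `S I := ∀ p ≤ 4, p ∈ I`, `Pin p c x y := π^*c = (x·secRe d p + y·secIm d p)·θᵖ`):
  `not_twistedWitness_of_extCount_of_cap` — if every `Adm`-admissible witness complex with the pins has the count
  (`e₂ = 12 ∧ 8 ≤ e₁ ≤ e₀ + 5`) and `Adm` caps `dim Hom ≤ r ≤ 2`, there is NO twisted witness; specialised to the crux's door capped
  at `r` (`not_twistedWitness_admTwCap_of_extCount`) and to the venture's ORIGINAL σ-notion `sigmaAdmissible` (`Hom(E,E) = ℂ` built in: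
  `not_twistedWitness_sigmaAdmissible_of_extCount`). The standing disprover's work file `Cruxes/SheafSeedGaussSq/Disproof.lean` §D names
  the count as one closed `Prop` (`SecantSemiregularExtCount`) and derives «STUB 1 with `dim End ≤ 2` is false» from it.

References: R.-O. Buchweitz, H. Flenner, Adv. Math. 217 (2008), Prop. 6.4.4, Thm. 6.4.2, Prop. 6.3.1 [`BuchweitzFlenner2008HH`];
— , Compositio Math. 137 (2003), Def. 4.1, §4.1, §5 [`BuchweitzFlenner2003`]; E. Markman, arXiv:2502.03415, Ex. 8.2.3, Question 8.2.4,
§8.1, Lemma 8.3.4 [`Markman2025SecantWeil`]; D. Mumford, Abelian Varieties, §16 [`MumfordAV1970`].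
-/

noncomputable section

open CategoryTheory AlgebraicGeometry
open Literature.AlgebraicGeometry Literature.AlgebraicGeometry.Motives Literature.AlgebraicGeometry.Modules
open Literature.AlgebraicGeometry.HodgeTheory Literature.AlgebraicGeometry.KTheory
open Literature.AlgebraicTopology.SingularHomology
open Summit.Ventures.HSemireg

namespace Summit.HodgeConjecture.HodgeConjecture.Theorems.SheafSeedGaussSq.Negative

set_option linter.dupNamespace false

/-! ## §1 The arithmetic of the Euler squeeze on an abelian fourfold -/

/-- **The Euler form on the secant plane, in the line's coordinates.** With `π^*κ_p = (x·secRe d p + y·secIm d p)·θᵖ`, the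
coordinates of `π^*κ` in the basis `θᵖ/p!` are `(x, y, −dx, −dy, d²x)`, and the Euler form `2v₀v₄ − 8v₁v₃ + 6v₂²` (HRR on a
fourfold with `∫θ⁴ = 4!`) equals `8d(dx² + y²)` — the instance `(ρ, τ, q) = (0, 1, 1)` of Markman's `8dq⁴τ²(a²τ²d + b²)`
(`Literature.AlgebraicGeometry.HodgeTheory.eulerForm_secant_markman`). [cite: Markman2025SecantWeil, §8.1 (Euler pairing of a secant class, n = 4)] -/
theorem eulerForm_secantPlane {R : Type*} [CommRing R] (d x y : R) :
    2 * x * (d ^ 2 * x) - 8 * y * (-(d * y)) + 6 * (-(d * x)) ^ 2 = 8 * d * (d * x ^ 2 + y ^ 2) := by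
  ring

/-- The same number from Markman's display at `(ρ, τ, q) = (0, 1, 1)` (consistency with the Literature rendering of §8.1).
[cite: Markman2025SecantWeil, §8.1 (Euler pairing of a secant class, n = 4)] -/
theorem eulerForm_secantPlane_eq_markman {R : Type*} [CommRing R] (d x y : R) :
    8 * d * (1 : R) ^ 4 * 1 ^ 2 * (x ^ 2 * 1 ^ 2 * d + y ^ 2) = 8 * d * (d * x ^ 2 + y ^ 2) := by
  ring

/-- **The squeeze.** Serre duality on the fourfold (`e₄ = e₀`, `e₃ = e₁`), `χ` the alternating sum (`Ext^{<0} = 0`, HRR),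
`e₂ = 12` (full `σ` injective on `Ext²` ⟺ `ob²` surjective, and `rank ob² = rank(⌟κ|HT²) = 12`) and `e₁ ≥ rank ob¹ ≥ rank(⌟κ|HT¹) = 8`
give `χ ≤ 2e₀ − 4`. [cite: BuchweitzFlenner2008HH, Prop. 6.4.4 and Thm. 6.4.2 (σ ∘ ob = ⌟ch for perfect complexes)]
[cite: MumfordAV1970, §16 (Riemann–Roch and Serre duality on abelian varieties)] -/
theorem euler_le_of_squeeze (e₀ e₁ e₂ e₃ e₄ χ : ℤ) (hS₄ : e₄ = e₀) (hS₃ : e₃ = e₁)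
    (hχ : χ = e₀ - e₁ + e₂ - e₃ + e₄) (he₂ : e₂ = 12) (he₁ : 8 ≤ e₁) : χ ≤ 2 * e₀ - 4 := by
  omega

/-- With `χ ≥ 1` (the Euler form of a non-zero secant class is positive, `eulerForm_secant_pos`, and `χ` is an integer) the
squeeze forces `dim Hom(E,E) = e₀ ≥ 3`. [cite: BuchweitzFlenner2008HH, Prop. 6.4.4 and Thm. 6.4.2 (σ ∘ ob = ⌟ch for perfect complexes)] -/
theorem three_le_endRank_of_squeeze (e₀ e₁ e₂ e₃ e₄ χ : ℤ) (hS₄ : e₄ = e₀) (hS₃ : e₃ = e₁)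
    (hχ : χ = e₀ - e₁ + e₂ - e₃ + e₄) (he₂ : e₂ = 12) (he₁ : 8 ≤ e₁) (hpos : 1 ≤ χ) : 3 ≤ e₀ := by
  omega

/-- **NEGATIVE #1 of the cell `pub-hsemireg` (numerical core): no fully semiregular secant object with `dim Hom(E,E) ≤ 2` on an
abelian fourfold** — the count is contradictory. [cite: BuchweitzFlenner2008HH, Prop. 6.4.4 and Thm. 6.4.2 (σ ∘ ob = ⌟ch for perfect complexes)]
[cite: Markman2025SecantWeil, Question 8.2.4] -/
theorem squeeze_false_of_endRank_le_two (e₀ e₁ e₂ e₃ e₄ χ : ℤ) (hS₄ : e₄ = e₀) (hS₃ : e₃ = e₁)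
    (hχ : χ = e₀ - e₁ + e₂ - e₃ + e₄) (he₂ : e₂ = 12) (he₁ : 8 ≤ e₁) (hpos : 1 ≤ χ) (h₀ : e₀ ≤ 2) : False := by
  omega

/-- **Markman's `F̄′` (Question 8.2.4) at every `d`.** For `F̄′ = [𝒪_Y → ν̄_*𝒪_{Z̃/G}]` on `Y = Pic³(C)/G`, `|G| = d + 1`:
`χ(F̄′,F̄′) = 8d(d+1)/(d+1) = 8d` (Markman's own count `∫ch(F_d)ch(F_d^∨) = 8d(d+1)`, Ex. 8.2.3) — a fully semiregular object with
these classes needs `e₀ ≥ 4d + 2 ≥ 6`, whereas `dim Hom(F̄′,F̄′) = 1` (cell: triangle `ν̄_*𝒪[−1] → F̄′ → 𝒪_Y`). The Literature window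
`markman_examples_window` (`χ ≤ 14 ⇒ d = 1`) is closed by the duality step `e₂ = 12`. [cite: Markman2025SecantWeil, Example 8.2.3 and Question 8.2.4] -/
theorem markmanFbarPrime_endRank_ge (d e₀ e₁ e₂ e₃ e₄ χ : ℤ) (hS₄ : e₄ = e₀) (hS₃ : e₃ = e₁)
    (hχ : χ = e₀ - e₁ + e₂ - e₃ + e₄) (he₂ : e₂ = 12) (he₁ : 8 ≤ e₁) (hχd : χ = 8 * d) : 4 * d + 2 ≤ e₀ := by
  omega

/-- Equivalently: with `e₀ = 1` and `χ = 8d`, `d ≥ 1`, the value `e₂ = 12` forced by full semiregularity is impossible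
(`e₂ = 8d − 2 + 2e₁ ≥ 8d + 14`). [cite: Markman2025SecantWeil, Example 8.2.3 and Question 8.2.4] -/
theorem markmanFbarPrime_extTwo_ne_twelve (d e₁ e₂ e₃ e₄ χ : ℤ) (hd : 1 ≤ d) (hS₄ : e₄ = 1) (hS₃ : e₃ = e₁)
    (hχ : χ = 1 - e₁ + e₂ - e₃ + e₄) (he₁ : 8 ≤ e₁) (hχd : χ = 8 * d) : e₂ ≠ 12 ∧ 8 * d + 14 ≤ e₂ := by
  constructor <;> omega

/-- A non-zero integer has square `≥ 1` (the rank `x = ch₀(E) ∈ ℤ ∖ {0}` of a secant object). [folklore] -/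
theorem one_le_sq_of_ne_zero (n : ℤ) (hn : n ≠ 0) : 1 ≤ n ^ 2 := by
  rcases lt_or_gt_of_ne hn with h | h <;> nlinarith

/-- **Level one (`j = 1`: `d = 1`, `deg π₁ = deg π₂ = 2`).** `2·χ_B = χ_J = 8(x² + y²)` with `x = ch₀(E) = n ∈ ℤ ∖ {0}`, so
`χ_B = 4(x² + y²) ≥ 4` and the squeeze `χ_B = 2e₀ − 2e₁ + 12`, `e₁ ≥ 8` gives `dim Hom(E,E) = e₀ ≥ 2 + 2(x² + y²) ≥ 4`: any witness of
the rung on `J/G₁` or `J/G₂` has a FOUR-dimensional endomorphism algebra at least. [cite: Markman2025SecantWeil, Example 8.2.3 and Question 8.2.4] -/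
theorem levelOne_four_le_endRank (e₀ e₁ : ℤ) (x y : ℚ) (n : ℤ) (hx : x = n) (hn : n ≠ 0) (he₁ : 8 ≤ e₁)
    (hE : (2 : ℚ) * (2 * e₀ - 2 * e₁ + 12) = 8 * (x ^ 2 + y ^ 2)) : 4 ≤ e₀ := by
  have hn1 : (1 : ℚ) ≤ (n : ℚ) ^ 2 := by exact_mod_cast one_le_sq_of_ne_zero n hn
  have hy : (0 : ℚ) ≤ y ^ 2 := sq_nonneg y
  subst hx
  have h4 : (4 : ℚ) ≤ 2 * (e₀ : ℚ) - 2 * (e₁ : ℚ) + 12 := by nlinarith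
  have h4' : (4 : ℤ) ≤ 2 * e₀ - 2 * e₁ + 12 := by exact_mod_cast h4
  omega

/-- **Level two (the line's declared fallback `j = 2`: `d = 4`, `deg πᵢ = 5`).** `5·χ_B = χ_J = 32(4x² + y²) ≥ 128`, so
`e₀ ≥ 15`. [cite: Markman2025SecantWeil, Example 8.2.3 and Question 8.2.4] -/
theorem levelTwo_fifteen_le_endRank (e₀ e₁ : ℤ) (x y : ℚ) (n : ℤ) (hx : x = n) (hn : n ≠ 0) (he₁ : 8 ≤ e₁)
    (hE : (5 : ℚ) * (2 * e₀ - 2 * e₁ + 12) = 32 * (4 * x ^ 2 + y ^ 2)) : 15 ≤ e₀ := by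
  have hn1 : (1 : ℚ) ≤ (n : ℚ) ^ 2 := by exact_mod_cast one_le_sq_of_ne_zero n hn
  have hy : (0 : ℚ) ≤ y ^ 2 := sq_nonneg y
  subst hx
  have h : (128 : ℚ) ≤ 5 * (2 * (e₀ : ℚ) - 2 * (e₁ : ℚ) + 12) := by nlinarith
  have h' : (128 : ℤ) ≤ 5 * (2 * e₀ - 2 * e₁ + 12) := by exact_mod_cast h
  omega

/-- At level two the UNTWISTED rank-one point `(x, y) = (±1, 0)` of the plane (`κ = Re exp(2iθ)`) is not even numerically
possible: `5·χ_B = 128` has no integer solution. [cite: Markman2025SecantWeil, Example 8.2.3 and Question 8.2.4] -/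
theorem levelTwo_rankOne_untwisted_false (e₀ e₁ : ℤ)
    (hE : (5 : ℚ) * (2 * e₀ - 2 * e₁ + 12) = 32 * (4 * (1 : ℚ) ^ 2 + 0 ^ 2)) : False := by
  have h : (5 : ℤ) * (2 * e₀ - 2 * e₁ + 12) = 128 := by
    have h' : (5 : ℚ) * (2 * e₀ - 2 * e₁ + 12) = 128 := by rw [hE]; norm_num
    exact_mod_cast h'
  omega

/-! ## §2 The squeeze at the level of the twisted object class

`twistedReflexiveClass C Adm n X₀ I κ` hides the witness complex `E`; the count is a property of `E`. The lemmas below are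
generic in the scheme `X₀`, the index condition `S` and the POINTWISE class pin `Pin p (κ p) x y` (only `p ∈ I` is pinned, exactly
as in the line's `HasSecantTwistedObjectOn`), so that the line file instantiates them by `Iff.rfl`-unfolding. -/

/-- **Count ∧ cap ⇒ no twisted witness.** If every `Adm`-admissible bounded complex of vector bundles `E` on `X₀` whose
`B₀`-twisted classes satisfy the pins has the count «`e₂ = 12`, `8 ≤ e₁ ≤ e₀ + 5`» (`e_k = extRank X₀ E k`; this is `χ ≥ 1` folded
into the squeeze), and `Adm` caps `extRank X₀ E 0 ≤ r` with `r ≤ 2`, then the twisted object class `twistedReflexiveClass C Adm`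
has NO member with the pins. Sorry-free bookkeeping; the count is the hypothesis `hcount`.
[cite: BuchweitzFlenner2008HH, Prop. 6.4.4 and Thm. 6.4.2 (σ ∘ ob = ⌟ch for perfect complexes)] -/
theorem not_twistedWitness_of_extCount_of_cap (C : ChernCharacterBetti) (Adm : PerfectAdmissibility) (n : ℕ)
    (X₀ : SchemeOver ℂ) (S : Finset ℕ → Prop) (Pin : (p : ℕ) → complexBetti X₀ (2 * p) → ℚ → ℚ → Prop) (r : ℕ)
    (hr : r ≤ 2)
    (hcount : ∀ (I : Finset ℕ) (E : CochainComplex X₀.left.Modules ℤ) (hE : IsBoundedVBComplex E)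
        (B₀ : complexBetti X₀ 2) (x y : ℚ), S I → Adm n X₀ I E → IsRationalClass B₀ → B₀ ∈ algebraicClasses X₀ 1 →
        x ≠ 0 → (∀ p ∈ I, Pin p (expTwistClasses X₀ B₀ (fun j => HodgeTheory.chPerfect C X₀ E hE.isFiniteLocallyFree j) p) x y) →
        ∃ e₀ e₁ : ℕ, extRank X₀ E 0 = e₀ ∧ extRank X₀ E 1 = e₁ ∧ extRank X₀ E 2 = 12 ∧ 8 ≤ e₁ ∧ e₁ ≤ e₀ + 5)
    (hcap : ∀ (I : Finset ℕ) (E : CochainComplex X₀.left.Modules ℤ), Adm n X₀ I E → extRank X₀ E 0 ≤ (r : Cardinal)) :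
    ¬ ∃ (I : Finset ℕ) (κ : (p : ℕ) → complexBetti X₀ (2 * p)) (x y : ℚ),
        S I ∧ twistedReflexiveClass C Adm n X₀ I κ ∧ x ≠ 0 ∧ ∀ p ∈ I, Pin p (κ p) x y := by
  rintro ⟨I, κ, x, y, hS, ⟨E, hE, B₀, hAdm, hBr, hBa, hκ⟩, hx, hpin⟩
  have hpin' : ∀ p ∈ I, Pin p (expTwistClasses X₀ B₀ (fun j => HodgeTheory.chPerfect C X₀ E hE.isFiniteLocallyFree j) p) x y :=
    fun p hp => hκ p hp ▸ hpin p hp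
  obtain ⟨e₀, e₁, h₀, -, -, h8, h5⟩ := hcount I E hE B₀ x y hS hAdm hBr hBa hx hpin'
  have hc := hcap I E hAdm
  rw [h₀] at hc
  have hle : e₀ ≤ r := by exact_mod_cast hc
  omega

/-- **The crux's twisted door CAPPED at `dim Hom ≤ r`, `r ≤ 2`: no secant-type witness, granted the count for
`gluableSigmaAdmissible ∨ bfSingleAdmissible'`-admissible complexes** (both disjuncts = full `σ` injective on `Ext²`, `Ext^{<0} = 0`).
The cap `r = 1` contains Markman's intended witness `F̄′` (`Hom(F̄′,F̄′) = ℂ`).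
[cite: BuchweitzFlenner2003, Def. 4.1 and §5 (I-semiregular)] [cite: Markman2025SecantWeil, Question 8.2.4] -/
theorem not_twistedWitness_admTwCap_of_extCount (C : ChernCharacterBetti) (n : ℕ) (X₀ : SchemeOver ℂ)
    (S : Finset ℕ → Prop) (Pin : (p : ℕ) → complexBetti X₀ (2 * p) → ℚ → ℚ → Prop) (r : ℕ) (hr : r ≤ 2)
    (hcount : ∀ (I : Finset ℕ) (E : CochainComplex X₀.left.Modules ℤ) (hE : IsBoundedVBComplex E)
        (B₀ : complexBetti X₀ 2) (x y : ℚ), S I →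
        (gluableSigmaAdmissible n X₀ I E ∨ bfSingleAdmissible' n X₀ I E) → IsRationalClass B₀ → B₀ ∈ algebraicClasses X₀ 1 →
        x ≠ 0 → (∀ p ∈ I, Pin p (expTwistClasses X₀ B₀ (fun j => HodgeTheory.chPerfect C X₀ E hE.isFiniteLocallyFree j) p) x y) →
        ∃ e₀ e₁ : ℕ, extRank X₀ E 0 = e₀ ∧ extRank X₀ E 1 = e₁ ∧ extRank X₀ E 2 = 12 ∧ 8 ≤ e₁ ∧ e₁ ≤ e₀ + 5) :
    ¬ ∃ (I : Finset ℕ) (κ : (p : ℕ) → complexBetti X₀ (2 * p)) (x y : ℚ),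
        S I ∧ twistedReflexiveClass C
          (fun n X₀ I E => (gluableSigmaAdmissible n X₀ I E ∨ bfSingleAdmissible' n X₀ I E) ∧ extRank X₀ E 0 ≤ (r : Cardinal))
          n X₀ I κ ∧ x ≠ 0 ∧ ∀ p ∈ I, Pin p (κ p) x y :=
  not_twistedWitness_of_extCount_of_cap C _ n X₀ S Pin r hr
    (fun I E hE B₀ x y hS hA hBr hBa hx hp => hcount I E hE B₀ x y hS hA.1 hBr hBa hx hp) (fun _ _ hA => hA.2)

/-- **The venture's ORIGINAL σ-notion `sigmaAdmissible` (`Hom(E,E) = ℂ` built in) has no secant-type witness, granted the count**: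
`sigmaAdmissible = gluableSigmaAdmissible ∧ extRank 0 = 1` (`sigmaAdmissible_iff_gluable_and_extRank_zero`), cap `r = 1`.
[cite: BuchweitzFlenner2003, Def. 4.1 and §5 (I-semiregular)] [cite: Markman2025SecantWeil, Question 8.2.4] -/
theorem not_twistedWitness_sigmaAdmissible_of_extCount (C : ChernCharacterBetti) (n : ℕ) (X₀ : SchemeOver ℂ)
    (S : Finset ℕ → Prop) (Pin : (p : ℕ) → complexBetti X₀ (2 * p) → ℚ → ℚ → Prop)
    (hcount : ∀ (I : Finset ℕ) (E : CochainComplex X₀.left.Modules ℤ) (hE : IsBoundedVBComplex E)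
        (B₀ : complexBetti X₀ 2) (x y : ℚ), S I →
        (gluableSigmaAdmissible n X₀ I E ∨ bfSingleAdmissible' n X₀ I E) → IsRationalClass B₀ → B₀ ∈ algebraicClasses X₀ 1 →
        x ≠ 0 → (∀ p ∈ I, Pin p (expTwistClasses X₀ B₀ (fun j => HodgeTheory.chPerfect C X₀ E hE.isFiniteLocallyFree j) p) x y) →
        ∃ e₀ e₁ : ℕ, extRank X₀ E 0 = e₀ ∧ extRank X₀ E 1 = e₁ ∧ extRank X₀ E 2 = 12 ∧ 8 ≤ e₁ ∧ e₁ ≤ e₀ + 5) :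
    ¬ ∃ (I : Finset ℕ) (κ : (p : ℕ) → complexBetti X₀ (2 * p)) (x y : ℚ),
        S I ∧ twistedReflexiveClass C (fun n X₀ I E => sigmaAdmissible n X₀ I E) n X₀ I κ ∧ x ≠ 0 ∧
          ∀ p ∈ I, Pin p (κ p) x y :=
  not_twistedWitness_of_extCount_of_cap C _ n X₀ S Pin 1 (by norm_num)
    (fun I E hE B₀ x y hS hA hBr hBa hx hp =>
      hcount I E hE B₀ x y hS (Or.inl (gluableSigmaAdmissible_of_sigmaAdmissible hA)) hBr hBa hx hp)
    (fun _ _ hA => by rw [(sigmaAdmissible_iff_gluable_and_extRank_zero.mp hA).2]; norm_num)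

end Summit.HodgeConjecture.HodgeConjecture.Theorems.SheafSeedGaussSq.Negative

end
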